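import Literature.AlgebraicGeometry.HodgeTheory.WeightOneHodgeStructuresOfTori
import Literature.AlgebraicGeometry.HodgeTheory.HodgeRiemannPolarizabilityProofs
import Literature.AlgebraicGeometry.HodgeTheory.AbelianVarietyHodgeEssentialImageRecord
import Literature.AlgebraicGeometry.Motives.GeometricVHSPolarizedTransport
import Literature.AlgebraicGeometry.Motives.AbelianVarietyProjectiveChart
import Literature.LinearAlgebra.DualRiemannData
import HarnessLib

/-!
# A projective complex torus admits a Riemann form

Lange–Birkenhake, *Complex Abelian Varieties*, §2.1 Thm. 2.1.13 with Prop. 2.1.11, direction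
(ii) ⇒ (i) through Hodge theory ("a complex torus is an abelian variety iff it admits a
polarisation"); C. Voisin, *Hodge Theory and Complex Algebraic Geometry I*, §7.2.2 Lemma 7.15 (a
polarisation of the weight-one Hodge structure of a torus is a Riemann form). In the tree's language:
let the complex torus `T = E/Φ(ℤ^κ)` (`ComplexTorus Φ`, `Φ : ℝ^κ ≃ E` a period isomorphism) be the
analytification `φ : T → X(ℂ)` (`IsAnalytification`) of a SMOOTH PROJECTIVE `X/ℂ` of dimension `n`.
Then `T` carries a Riemann form, i.e. `ComplexTorus.IsAbelianVariety Φ` holds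
(`isAbelianVariety_of_isAnalytification`). The corollary
`complexAbelianVariety_torus_isAbelianVariety` is, verbatim, the hypothesis `hpol` of
`ModuliOfAbelianVarieties/SiegelModuliFibreOccurrence` ("the uniformising torus of a complex abelian
variety admits a Riemann form"), which it thereby retires.

## Proof

1. COHOMOLOGY SIDE (`exists_cohomologyRiemannData_of_isAnalytification`). By
   `exists_hodgeModel_weightOne_of_complexTorus` there are a Hodge-symmetric Hodge model `B` of `X`
   and lattice coordinates `u : H¹(X(ℂ); ℚ) ≃ ℚ^κ` under which `F¹ = H^{1,0}` consists of the
   lattice coordinates `(ℓ(Φ e_b))_b` of `ℂ`-linear functionals `ℓ` on `E`. The weight-one Hodge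
   structure `H¹_B` is polarisable (`smoothProjective_hodgeStructure_isPolarizable_holds`, the
   Hodge–Riemann bilinear relations) and effective (`HodgeModel.isEffective_hodgeStructure`); both
   properties are transported to `ℚ^κ` along `u` (`HodgeStructure.comapEquiv`,
   `IsPolarizable.comapEquiv`, `IsEffective.comapEquiv`). Riemann's linear algebra
   (`exists_cx_riemannForm_of_isPolarizable`, Voisin Lemma 7.15) then gives a complex structure `J`
   on `ℝ ⊗_ℚ ℚ^κ` with `F¹ = {a + iJa}` and a rational alternating `J`-invariant form `Q` with
   `Q_ℝ(a, Ja) > 0`; we read them in the coordinates `ℝ ⊗_ℚ ℚ^κ ≅ ℝ^κ` of the base-changed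
   standard basis. This is Riemann data on the COHOMOLOGY lattice space `ℝ^κ = Λ^∨ ⊗ ℝ`.
2. `dotProduct_latticeJ_eq_neg`: the `F¹`-description pins `J` down as minus the transpose of the
   complex structure `J_Φ = Φ⁻¹ ∘ i ∘ Φ` of the PERIOD lattice space (`ComplexTorus.latticeJ Φ`) for
   the standard pairing `Λ^∨ × Λ → ℚ`: `⟪J_Φ x, y⟫ = -⟪x, J y⟫`.
3. DUALISATION (`Literature.LinearAlgebra.exists_dualRiemannData`, Lange–Birkenhake §2.4–§2.5, the
   dual polarisation): Riemann data for `(J, Q)` on `Λ^∨_ℝ` give Riemann data for `(J_Φ, Q⁻¹)` on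
   `Λ_ℝ` (inverse Gram matrix). This step is unavoidable: Hodge theory polarises `H¹ = Λ^∨`, while
   `IsAbelianVariety Φ` asks Riemann's conditions on the period lattice `Λ`, and `T ≅ T̂` only
   through a polarisation.
4. Clearing denominators (`exists_nat_pos_mul_eq_int`) and `ComplexTorus.isAbelianVariety_of_bilinForm`.

Everything is proved; no definition, no named fact. Mathlib has no complex tori, Riemann forms or
Hodge structures; all inputs are the tree's (`HodgeTheory/ComplexTorusWeightOneComparison`,
`HodgeTheory/HodgeRiemannPolarizabilityProofs`, `HodgeTheory/WeightOneHodgeStructuresOfCurvesProofs`,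
`Motives/GeometricVHSPolarizedTransport`, `Geometry/Kaehler/ComplexTorusOfComplexStructure`,
`LinearAlgebra/DualRiemannData`). NOT here: the converse direction (Lefschetz: a torus with a
Riemann form is projective), which is `ComplexTorus.IsAbelianVariety`'s raison d'être elsewhere in
the tree.

## References

* [LangeBirkenhake1992] H. Lange, Ch. Birkenhake, Complex Abelian Varieties, Springer (1992), §2.1
  Prop. 2.1.11, Thm. 2.1.13; §2.4, §2.5.1 Prop. 2.5.1; §1.1 Lemma 1.1.17, Thm. 1.1.21.
* [VoisinHodgeI2002] C. Voisin, Hodge Theory and Complex Algebraic Geometry I, CUP (2002), §7.2.2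
  Lemma 7.15 (PDF pp. 141–143).
-/

noncomputable section

open scoped TensorProduct

namespace Literature.AlgebraicGeometry.HodgeTheory

open Literature.AlgebraicGeometry.Motives Literature.Geometry.Kaehler
open Literature.AlgebraicGeometry.Motives.HodgeStructure
open Literature.NumberTheory.Transcendental (IsAnalytification)
open Matrix

/-! ### Transport of effectivity -/

/-- Effectivity of a Hodge structure is transported along a linear equivalence: the pieces of
`H.comapEquiv e` are the pull-backs `e_ℂ⁻¹(W^{p,q})` (`HodgeStructure.comapEquiv_piece`) and `e_ℂ`
is injective, so `H.comapEquiv e` has the same non-zero Hodge pieces `V^{p,q}`, `p, q ≥ 0`, as `H`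
(Voisin I, §7.1.1 Def. 7.4 and §7.3.1: an isomorphism of Hodge structures respects the Hodge
decomposition). (Dot-notation extension of `Motives.HodgeStructure.IsEffective`, declared with its
absolute name next to its sibling `IsPolarizable.comapEquiv`.)
[cite: VoisinHodgeI2002, §7.1.1 Def. 7.4 and §7.3.1 Def. 7.24] -/
theorem _root_.Literature.AlgebraicGeometry.Motives.HodgeStructure.IsEffective.comapEquiv
    {V W : Type*} [AddCommGroup V] [Module ℚ V] [AddCommGroup W] [Module ℚ W] {n : ℤ}
    {H : HodgeStructure W n} (hH : H.IsEffective) (e : V ≃ₗ[ℚ] W) :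
    (H.comapEquiv e).IsEffective := fun p q hne => hH p q fun hbot => hne (by
  rw [HodgeStructure.comapEquiv_piece, hbot, Submodule.comap_bot]
  exact LinearMap.ker_eq_bot.2 (HodgeStructure.baseChange_injective_of_equiv e))

variable {κ : Type} [Fintype κ] [DecidableEq κ] {E : Type} [NormedAddCommGroup E] [NormedSpace ℂ E]
  [FiniteDimensional ℂ E] (Φ : (κ → ℝ) ≃L[ℝ] E)

/-! ### Step 1: Riemann data on the cohomology lattice space -/

/-- **Riemann data on the cohomology lattice space of a projective torus.** If the complex torus
`E/Φ(ℤ^κ)` is the analytification of a smooth projective `X/ℂ`, there are a complex structure `J`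
on `ℝ^κ = H¹(T; ℝ) = Λ^∨_ℝ` and a real alternating `J`-invariant bilinear form `B` with
`B(x, Jx) > 0` for `x ≠ 0`, RATIONAL on the standard basis, whose `(1,0)`-vectors `a + iJa` are
exactly lattice coordinates `(ℓ(Φ e_b))_b` of `ℂ`-linear functionals `ℓ` on `E`
(Voisin I §7.2.2: "`H^{1,0}(T) = V^*`" and Lemma 7.15: a polarisation `Q` of `H¹` satisfies
`Q(Ja, Jc) = Q(a, c)`, `Q(a, Ja) > 0`). Proof: `exists_hodgeModel_weightOne_of_complexTorus`
(model `B`, coordinates `u`, `F¹`-description) · polarisability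
(`smoothProjective_hodgeStructure_isPolarizable_holds`) and effectivity
(`HodgeModel.isEffective_hodgeStructure`) of `H¹_B`, transported along `u`
(`HodgeStructure.comapEquiv`) · `exists_cx_riemannForm_of_isPolarizable` · coordinates
`((Pi.basisFun ℚ κ).baseChange ℝ).equivFun : ℝ ⊗_ℚ ℚ^κ ≃ ℝ^κ`, under which `w + iJw ∈ F¹`
(`mkCx_mem_cxF1`) is read through `u` by real and imaginary parts.
[cite: VoisinHodgeI2002, §7.2.2 Lemma 7.15 (PDF pp. 141–143)]
[cite: LangeBirkenhake1992, §1.1 Thm. 1.1.21 and §2.1 Thm. 2.1.13] -/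
theorem exists_cohomologyRiemannData_of_isAnalytification {n : ℕ} {X : SchemeOver ℂ} (hX : IsSmoothProjective n X)
    (φ : ComplexTorus Φ → ComplexPoints X) (hφ : IsAnalytification E X n φ) :
    ∃ (J : (κ → ℝ) →ₗ[ℝ] (κ → ℝ)) (B : LinearMap.BilinForm ℝ (κ → ℝ)),
      (∀ a, J (J a) = -a) ∧ (∀ x, B x x = 0) ∧ (∀ x y, B (J x) (J y) = B x y) ∧
      (∀ x, x ≠ 0 → 0 < B x (J x)) ∧
      (∀ i j, ∃ q : ℚ, B (Pi.single i 1) (Pi.single j 1) = q) ∧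
      ∀ a : κ → ℝ, ∃ ℓ : E →L[ℂ] ℂ,
        ∀ b, ℓ (Φ (Pi.single b 1)) = (a b : ℂ) + (J a b : ℂ) * Complex.I := by
  -- a Hodge-symmetric Hodge model `B`, lattice coordinates `u : H¹(X(ℂ); ℚ) ≃ ℚ^κ`, and the
  -- `F¹`-description `(u ⊗ ℂ)(F¹) ∋ Σ_b ℓ(Φ e_b) ⊗ e_b`
  obtain ⟨B, hB, u, hu⟩ := exists_hodgeModel_weightOne_of_complexTorus Φ hX φ hφ
  -- the weight-one Hodge structure on `H¹(X(ℂ); ℚ)` transported to `ℚ^κ` along `u`: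
  -- polarisable (Hodge–Riemann) and effective
  have hpol : (((B.hodgeStructure hX hB 1).cast Nat.cast_one).comapEquiv u.symm).IsPolarizable :=
    ((smoothProjective_hodgeStructure_isPolarizable_holds hX B hB 1).cast Nat.cast_one).comapEquiv
      u.symm
  have heff : (((B.hodgeStructure hX hB 1).cast Nat.cast_one).comapEquiv u.symm).IsEffective :=
    ((HodgeModel.isEffective_hodgeStructure B hX hB 1).cast Nat.cast_one).comapEquiv u.symm
  -- Riemann's linear algebra: complex structure `J` on `ℝ ⊗ ℚ^κ` and a rational Riemann form `Q`
  obtain ⟨J, hJ, Q, hQalt, hQJ, hQpos, -, hQH⟩ :=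
    exists_cx_riemannForm_of_isPolarizable _ hpol heff
  -- coordinates `θ : ℝ ⊗_ℚ ℚ^κ ≃ ℝ^κ` (the base-changed standard basis)
  let θ : ℝ ⊗[ℚ] (κ → ℚ) ≃ₗ[ℝ] (κ → ℝ) := ((Pi.basisFun ℚ κ).baseChange ℝ).equivFun
  have hθ_basis : ∀ i, θ (((Pi.basisFun ℚ κ).baseChange ℝ) i) = Pi.single i 1 := fun i => by
    funext j
    rw [Module.Basis.equivFun_self, Pi.single_apply]
    simp only [eq_comm]
  have hθsymm_single : ∀ i, θ.symm (Pi.single i 1) = (1 : ℝ) ⊗ₜ[ℚ] Pi.single i (1 : ℚ) :=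
    fun i => by
    rw [← hθ_basis, θ.symm_apply_apply, Module.Basis.baseChange_apply, Pi.basisFun_apply]
  have hθ_sum : ∀ r : κ → ℝ, θ (∑ b, r b ⊗ₜ[ℚ] Pi.single b (1 : ℚ)) = r := fun r => by
    have h : ∑ b, r b ⊗ₜ[ℚ] Pi.single b (1 : ℚ) = θ.symm r := by
      rw [Module.Basis.equivFun_symm_apply]
      refine Finset.sum_congr rfl fun b _ => ?_
      rw [Module.Basis.baseChange_apply, Pi.basisFun_apply, TensorProduct.smul_tmul', smul_eq_mul,
        mul_one]
    rw [h, θ.apply_symm_apply]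
  -- transport `J` and `Q_ℝ` to `ℝ^κ`
  refine ⟨θ.toLinearMap ∘ₗ J ∘ₗ θ.symm.toLinearMap,
    (Q.baseChange ℝ).comp θ.symm.toLinearMap θ.symm.toLinearMap, fun a => ?_, fun x => ?_,
    fun x y => ?_, fun x hx => ?_, fun i j => ?_, fun a => ?_⟩
  · simp only [LinearMap.comp_apply, LinearEquiv.coe_coe, θ.symm_apply_apply, hJ, map_neg,
      θ.apply_symm_apply]
  · rw [LinearMap.BilinForm.comp_apply]
    exact baseChange_real_self Q hQalt _
  · simp only [LinearMap.BilinForm.comp_apply, LinearMap.comp_apply, LinearEquiv.coe_coe,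
      θ.symm_apply_apply, hQJ]
  · simp only [LinearMap.BilinForm.comp_apply, LinearMap.comp_apply, LinearEquiv.coe_coe,
      θ.symm_apply_apply]
    exact hQpos _ fun h => hx (by rw [← θ.apply_symm_apply x, h, map_zero])
  · refine ⟨Q (Pi.single i 1) (Pi.single j 1), ?_⟩
    rw [LinearMap.BilinForm.comp_apply, LinearEquiv.coe_coe, hθsymm_single, hθsymm_single,
      LinearMap.BilinForm.baseChange_tmul, mul_one, Rat.smul_one_eq_cast]
  · -- the `(1,0)`-vector `w + iJw`, `w = θ⁻¹ a`, lies in `F¹ = cxF1 J`; read it through `u`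
    have hmem : mkCx (θ.symm a) (J (θ.symm a)) ∈
        (((B.hodgeStructure hX hB 1).cast Nat.cast_one).comapEquiv u.symm).F 1 := by
      rw [← hQH, hodgeStructureOfCx_F_one]
      exact mkCx_mem_cxF1 J hJ _
    rw [comapEquiv_F, Submodule.mem_comap, cast_F] at hmem
    obtain ⟨ℓ, hℓ⟩ := hu _ hmem
    rw [baseChange_apply_symm_baseChange] at hℓ
    -- `hℓ : w + iJw = Σ_b ℓ(Φ e_b) ⊗ e_b`; take real and imaginary parts and coordinates
    refine ⟨ℓ, fun b => ?_⟩
    have hre := congrArg rePart hℓ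
    have him := congrArg imPart hℓ
    rw [rePart_mkCx, map_sum] at hre
    rw [imPart_mkCx, map_sum] at him
    simp only [rePart_tmul] at hre
    simp only [imPart_tmul] at him
    have ha : a = fun c => (ℓ (Φ (Pi.single c 1))).re := by
      rw [← θ.apply_symm_apply a, hre, hθ_sum]
    have hJa : θ (J (θ.symm a)) = fun c => (ℓ (Φ (Pi.single c 1))).im := by
      rw [him, hθ_sum]
    rw [LinearMap.comp_apply, LinearMap.comp_apply, LinearEquiv.coe_coe, LinearEquiv.coe_coe, hJa,
      show a b = (ℓ (Φ (Pi.single b 1))).re from congrFun ha b]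
    exact (Complex.re_add_im _).symm

/-! ### Step 2: the complex structure on `Λ^∨_ℝ` is minus the transpose of `J_Φ` -/

omit [FiniteDimensional ℂ E] in
/-- **`J = -J_Φᵀ`.** If every real vector `a ∈ ℝ^κ` has a `ℂ`-linear functional `ℓ` on `E` with
lattice coordinates `ℓ(Φ e_b) = a_b + i (Ja)_b`, then `⟪J_Φ x, y⟫ = -⟪x, J y⟫` for the standard
pairing, `J_Φ = Φ⁻¹ ∘ i ∘ Φ` (`ComplexTorus.latticeJ`): for `y` take `ℓ`; `ℝ`-linearity of `ℓ ∘ Φ`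
gives `ℓ(Φ x) = ⟪x, y⟫ + i⟪x, Jy⟫`, and `ℂ`-linearity at `Φ(J_Φ x) = iΦx`
(`ComplexTorus.apply_latticeJ`) compares real parts (Voisin I §7.2.2: "the Hodge structure on
`H¹(T)` is dual to that of" `(V, J)`). Proof by litscope-2 (gen 10) of the `pub-hodgecm2` cell.
[cite: VoisinHodgeI2002, §7.2.2 (PDF p. 142)] -/
theorem dotProduct_latticeJ_eq_neg (J : (κ → ℝ) →ₗ[ℝ] (κ → ℝ))
    (hF : ∀ a : κ → ℝ, ∃ ℓ : E →L[ℂ] ℂ,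
      ∀ b, ℓ (Φ (Pi.single b 1)) = (a b : ℂ) + (J a b : ℂ) * Complex.I) :
    ∀ x y : κ → ℝ, dotProduct (ComplexTorus.latticeJ Φ x) y = -dotProduct x (J y) := by
  intro x y
  obtain ⟨ℓ, hℓ⟩ := hF y
  -- `ℓ (Φ v) = ⟪v, y⟫ + i ⟪v, J y⟫` for every real vector `v`
  have key : ∀ v : κ → ℝ,
      ℓ (Φ v) = ((dotProduct v y : ℝ) : ℂ) + ((dotProduct v (J y) : ℝ) : ℂ) * Complex.I := by
    intro v
    have hv : v = ∑ b, v b • (Pi.single b (1 : ℝ) : κ → ℝ) := by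
      ext j
      simp [Finset.sum_apply, Pi.single_apply]
    conv_lhs => rw [hv, map_sum, map_sum]
    have hsm : ∀ b, ℓ (Φ (v b • (Pi.single b (1 : ℝ) : κ → ℝ))) =
        (v b : ℂ) * ℓ (Φ (Pi.single b 1)) := by
      intro b
      rw [Φ.map_smul, ← Complex.coe_smul, ℓ.map_smul, smul_eq_mul]
    simp_rw [hsm, hℓ]
    simp only [dotProduct, mul_add, Finset.sum_add_distrib, Complex.ofReal_sum, Complex.ofReal_mul,
      Finset.sum_mul, mul_assoc]
  have h1 := key (ComplexTorus.latticeJ Φ x)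
  rw [ComplexTorus.apply_latticeJ, ℓ.map_smul, key x, smul_eq_mul] at h1
  have h2 := congrArg Complex.re h1
  simp only [Complex.mul_re, Complex.add_re, Complex.add_im, Complex.ofReal_re, Complex.ofReal_im,
    Complex.mul_im, Complex.I_re, Complex.I_im, mul_zero, mul_one, zero_mul, one_mul, zero_add,
    add_zero, sub_zero, zero_sub] at h2
  linarith

/-! ### Assembly -/

/-- **A projective complex torus admits a Riemann form.** If the complex torus `E/Φ(ℤ^κ)` is the
analytification of a smooth projective complex variety, then `ComplexTorus.IsAbelianVariety Φ`: there
is a real alternating bilinear form `B` on `ℝ^κ`, invariant under `J_Φ = Φ⁻¹ ∘ i ∘ Φ`, integral on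
the lattice `ℤ^κ`, with `B(J_Φ x, x) > 0` for `x ≠ 0` (Lange–Birkenhake Thm. 2.1.13 (ii) ⇒ (i) with
Prop. 2.1.11; Voisin I §7.2.2 Lemma 7.15). Proof: Riemann data `(J, B₁)` on the cohomology lattice
space (`exists_cohomologyRiemannData_of_isAnalytification`), `J = -J_Φᵀ`
(`dotProduct_latticeJ_eq_neg`), the dual Riemann data `B₂ = B₁⁻¹` for `J_Φ`
(`Literature.LinearAlgebra.exists_dualRiemannData`, the dual polarisation, Lange–Birkenhake §2.5.1),
clearing denominators (`exists_nat_pos_mul_eq_int`) and `ComplexTorus.isAbelianVariety_of_bilinForm`.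
[cite: LangeBirkenhake1992, §2.1 Prop. 2.1.11 and Thm. 2.1.13, §2.5.1 Prop. 2.5.1]
[cite: VoisinHodgeI2002, §7.2.2 Lemma 7.15 (PDF pp. 141–143)] -/
theorem isAbelianVariety_of_isAnalytification {n : ℕ} {X : SchemeOver ℂ} (hX : IsSmoothProjective n X)
    (φ : ComplexTorus Φ → ComplexPoints X) (hφ : IsAnalytification E X n φ) :
    ComplexTorus.IsAbelianVariety Φ := by
  obtain ⟨J, B, hJ, h0, hinv, hpos, hrat, hF⟩ :=
    exists_cohomologyRiemannData_of_isAnalytification Φ hX φ hφ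
  have hadj := dotProduct_latticeJ_eq_neg Φ J hF
  obtain ⟨B₂, h0₂, hinv₂, hpos₂, hrat₂⟩ :=
    Literature.LinearAlgebra.exists_dualRiemannData J (ComplexTorus.latticeJ Φ) hJ hadj B h0 hinv
      hpos hrat
  choose q hq using hrat₂
  obtain ⟨N, hN, hk⟩ := exists_nat_pos_mul_eq_int fun ij : κ × κ => q ij.1 ij.2
  refine ComplexTorus.isAbelianVariety_of_bilinForm Φ (B := (N : ℝ) • B₂) (fun x => ?_)
    (fun x y => ?_) (fun i j => ?_) (fun x hx => ?_)
  · simp only [LinearMap.smul_apply, smul_eq_mul, h0₂, mul_zero]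
  · simp only [LinearMap.smul_apply, smul_eq_mul, hinv₂]
  · obtain ⟨k, hk'⟩ := hk (i, j)
    refine ⟨k, ?_⟩
    simp only [LinearMap.smul_apply, smul_eq_mul, hq]
    exact_mod_cast hk'
  · simp only [LinearMap.smul_apply, smul_eq_mul]
    exact mul_pos (by exact_mod_cast hN) (hpos₂ x hx)

/-- **The uniformising torus of a complex abelian variety admits a Riemann form**: for every complex
abelian variety `A`, every period isomorphism `Φ : ℝ^κ ≃ ℂ^{dim A}` and every analytification
`φ : ℂ^{dim A}/Φ(ℤ^κ) → A(ℂ)`, `ComplexTorus.IsAbelianVariety Φ` — `isAbelianVariety_of_isAnalytification`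
with `AbelianVariety.isSmoothProjective_holds`. This is VERBATIM the hypothesis `hpol` of
`SiegelModuliFibreOccurrence.forall_abelianVariety_exists_isPolarizationType_forall_nonempty_iso_fiberOver`
and of `MumfordTateSubfamily`'s uniformised corollaries, which it discharges.
[cite: LangeBirkenhake1992, §2.1 Prop. 2.1.11 and Thm. 2.1.13] -/
theorem complexAbelianVariety_torus_isAbelianVariety :
    ∀ (A : AbelianVariety ℂ) (κ : Type) [Fintype κ] [DecidableEq κ]
      (Φ : (κ → ℝ) ≃L[ℝ] (Fin A.dim → ℂ)) (φ : ComplexTorus Φ → ComplexPoints A.X),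
      IsAnalytification (Fin A.dim → ℂ) A.X A.dim φ → ComplexTorus.IsAbelianVariety Φ :=
  fun A _κ _ _ Φ φ hφ =>
    isAbelianVariety_of_isAnalytification Φ (AbelianVariety.isSmoothProjective_holds (A := A)) φ hφ

end Literature.AlgebraicGeometry.HodgeTheory

end
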